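import Summits.BirchSwinnertonDyer.BirchSwinnertonDyer.Theorems.GenusKolyvaginAtTwoMinimalTwinBSDTwoRouteLedgerLine25Supplies
import Summits.BirchSwinnertonDyer.BirchSwinnertonDyer.Theorems.GenusKolyvaginAtTwoMinimalTwinBSDTwoRouteLedgerLine25Surjective
import Summits.BirchSwinnertonDyer.Rank1Residual.F1Sign2.DescentSignAtTwo
import HarnessLib

/-!
# Route `GenusKolyvaginAtTwo` (rev 57/58), crux U₂ `MinimalTwinBSDTwo` (stmt-BirchSwinnertonDyer-22985): THE EGG-SPLIT LEDGER —
# `closes` with U₂ replaced by «sliced WALL + S2″⁺ (LINE 23 v1.5's egg-restricted reversed supply) + S2⁻′ + the DECLARED RESIDUAL hTw0^{id}»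

Seat `bsd-line-gk2-p3` g28 (PROVER seat 3/3, cell `bsd-f1-sign2`), `--supports stmt-BirchSwinnertonDyer-22985` (helper; closes nothing).
THEOREMS ONLY (no definition, no named fact, no `sorry`); standard axioms.  **BSD is NOT proved by this file; U₂ / hTw0 / hTw1 / the wall /
the supplies / the residual are NOT proved; no item is closed.**  CONDITIONAL on the displayed hypotheses exactly like this seat's rev-57
ledgers (`…RouteLedgerLine25Supplies`, p768862; `…RouteLedgerLine25Surjective`, p769550), of which it is the EGG-SPLIT refinement asked for
by the reshape of LINE 23 to v1.5 (gk2-p2 g24, STATUS 11:12Z) after this seat's finding `…EggSplit` (p769884): on the `Δ > 0` cell a reversed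
ALL-SILENT `2`-Selmer-trivial twin exists only for curves MEETING THE EGG.

* §1 **`hTw0egg_of_slicedWall_of_reversedSupplyExponentEgg_of_facts`** — `hTw0^{egg} ⟸ S1⁺ + S2″⁺ + PRINT`: S2″⁺ := LINE 23 v1.3's S2″
  (`ReversedMinimalSupplyAtTwoExponent`) with ONE extra premise `W.Δ < 0 ∨ MeetsEgg W` (v1.5's `ReversedMinimalSupplyAtTwoExponentEgg`, modulo
  the position of that premise), every other character verbatim; engine g23's `swappedPairDescentAtTwo_maninExponent_of_facts` (p766443) via
  p768862's proof verbatim; conclusion = `BSD₂` on `hTw0^{egg}` := (non-CM, `r_an = 1`, `#Sel₂ = 2`, `0 < Δ`, `ord₂ C = 0`, `MeetsEgg`).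
* §2 **`nonCMAtTwo_of_items_of_slicedWall_of_reversedSuppliesEgg_line25`** — `closes` (rev 57) with `hTw : MinimalTwinBSDTwo` REPLACED by
  S1⁺ + S1⁻ + S2″⁺ + S2⁻′ + **`hTw0id`** := `BSD₂` for non-CM globally minimal `W` with `r_an = 1`, `#Sel₂ = 2`, `ρ̄_{W,2}` onto, `0 < Δ`,
  `ord₂ C(W) = 0` and **`W(ℚ) ⊂ W⁰(ℝ)`** (¬`MeetsEgg`) — the ε = −1 sub-cell, a DECLARED RESIDUAL (v1.5's S4″ ∩ the cells `closes` consumes;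
  `closes` hands U₂ exactly such twins from the wide-Selmer habitat curves).  Built on `Line25.nonCMAtTwo_of_items_of_tamagawaSlicedSurjTwin_line25`
  (the S₃-sliced `closes`) by splitting `hTw0ˢ` on `MeetsEgg`.  NET (planner currency, rev 58):
  **U₂|`closes` ⟸ S1⁺ + S1⁻ + S2″⁺ + S2⁻′ + hTw0^{id,S₃} + PRINT**, and hTw0^{id,S₃} wants the two-transposition door (sibling line T-2q / AN-26),
  not an all-silent supply (`Egg.natCard_selmerGroup_twin_of_silent`: impossible).

References: [Kramer1981] §2 Props. 3, 6; [MazurRubin2010] Cor. 3.4 (i); [GrossZagier1986] V.§2 (2.2); [Milne1972ArithmeticAV] §1 Thm. 1;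
[Miller2011LMS] Def. 1.1.
-/

set_option autoImplicit false
set_option linter.dupNamespace false -- `Summit.<P>.<Sub>` repeats `BirchSwinnertonDyer` (D-0017)

noncomputable section

open scoped Classical

open WeierstrassCurve NumberField Literature.NumberTheory.EllipticCurves
  Literature.NumberTheory.EllipticCurves.ModularForms
  Literature.NumberTheory.EllipticCurves.Rank1Residual
  Literature.NumberTheory.EllipticCurves.Rank1Residual.Typed
  Literature.NumberTheory.EllipticCurves.KrizLi2019
  Summit.BirchSwinnertonDyer.Rank1Residual
  Summit.BirchSwinnertonDyer.Rank1Residual.AdditivePotMult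
  Summit.BirchSwinnertonDyer.Rank1Residual.F1Sign2
  Summit.BirchSwinnertonDyer.BirchSwinnertonDyer.Rank1Residual
  Summit.BirchSwinnertonDyer.BirchSwinnertonDyer.Theses.GenusKolyvaginAtTwo
  Summit.BirchSwinnertonDyer.BirchSwinnertonDyer.Theorems.CMExactDescent
  Summit.BirchSwinnertonDyer.BirchSwinnertonDyer.Theorems.GenusExact.TwinSwap
  Summit.BirchSwinnertonDyer.BirchSwinnertonDyer.Theorems.GenusExact.TwinSwap.OneBit
  Summit.BirchSwinnertonDyer.BirchSwinnertonDyer.Theorems.GenusExact.PlusDescent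

namespace Summit.BirchSwinnertonDyer.BirchSwinnertonDyer.Theorems.GenusExact.TwinSwap.Ledger.Line25

/-! ## §1 The egg sub-cell `hTw0^{egg}` from the sliced wall, S2″⁺ and PRINT -/

/-- **`hTw0^{egg} ⟸ S1⁺ + S2″⁺ + PRINT`.**  `hS1pos` = the wall sliced to (`r_an = 0`, `#Sel₂ = 1`, `Δ > 0`, `ord₂ C = 0`); `hS2egg` = LINE 23's
S2″ with the extra premise `W.Δ < 0 ∨ MeetsEgg W` (v1.5's S2″⁺); the four PRINT facts.  Conclusion: `BSD₂` for every non-CM globally minimal `W`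
with `r_an = 1`, `#Sel₂ = 2`, `0 < Δ`, `ord₂ C(W) = 0` that MEETS THE EGG.  Proof = p768862 §1 verbatim with the premise fed by `Or.inr`.
CONDITIONAL on the displayed hypotheses; BSD is NOT proved; nothing is closed.
[cite: GrossZagier1986, V.§2 (2.2)] [cite: Milne1972ArithmeticAV, §1 Thm. 1] [cite: Kramer1981, §2 Prop. 6] [cite: Miller2011LMS, Def. 1.1] -/
theorem hTw0egg_of_slicedWall_of_reversedSupplyExponentEgg_of_facts
    (hGZ : ∀ (N : ℕ) [NeZero N] (W : WeierstrassCurve ℚ) (K : Type) [Field K] [NumberField K], gross_zagier N W K)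
    (hGZK : rank_eq_analyticRank_of_analyticRank_le_one) (hmod : hasEntireLFunction_rat)
    (hMilneC : Milne1972.bsdQuotient_baseChange_quadratic_anyModel)
    (hS1pos : ∀ (W : WeierstrassCurve ℚ) [W.IsElliptic] [W.IsGloballyMinimal],
      ¬ W.HasCM → W.analyticRank = 0 → Nat.card (W.selmerGroup 2) = 1 → 0 < W.Δ → padicValNat 2 W.tamagawaProduct = 0 → BSDp W 2)
    (hS2egg : ∀ (W : WeierstrassCurve ℚ) [W.IsElliptic] [W.IsGloballyMinimal] [NeZero (W.conductorNorm ℤ)],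
      ¬ W.HasCM → W.analyticRank = 1 → Nat.card (W.selmerGroup 2) = 2 → Odd W.tamagawaProduct → (W.Δ < 0 ∨ MeetsEgg W) →
      ∃ (K : Type) (_ : Field K) (_ : NumberField K),
        IsImaginaryQuadratic K ∧ Odd (NumberField.discr K) ∧ NumberField.discr K ≠ -3 ∧ SatisfiesHeegnerHypothesis (W.conductorNorm ℤ) K ∧
        ∃ (Dt : ModularParametrizationData W (W.conductorNorm ℤ)) (β : ℤ) (ι : K →+* ℂ) (d₁ : KolyvaginHeegnerData Dt β ι 1),
          Dt.c ≠ 0 ∧ ¬ IsOfFinAddOrder d₁.derivedPoint ∧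
          (∃ M₀ : ℕ, padicValInt 2 Dt.c = M₀ ∧
            (∃ Q : (W.baseChange (ringClassField K ι 1)).toAffine.Point, ((2 ^ M₀ : ℕ) : ℤ) • Q = d₁.derivedPoint) ∧
            (¬ ∃ Q : (W.baseChange (ringClassField K ι 1)).toAffine.Point, ((2 ^ (M₀ + 1) : ℕ) : ℤ) • Q = d₁.derivedPoint)) ∧
          ∃ (Wd : WeierstrassCurve ℚ) (_ : Wd.IsElliptic) (_ : Wd.IsGloballyMinimal),
            (∃ C : VariableChange ℚ, C • W.quadraticTwist (NumberField.discr K : ℚ) = Wd) ∧ Nat.card (Wd.selmerGroup 2) = 1 ∧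
            ((W.Δ < 0 ∧ padicValNat 2 Wd.tamagawaProduct ≤ 1) ∨ padicValNat 2 Wd.tamagawaProduct = 0)) :
    ∀ (W : WeierstrassCurve ℚ) [W.IsElliptic] [W.IsGloballyMinimal], ¬ W.HasCM → W.analyticRank = 1 →
      Nat.card (W.selmerGroup 2) = 2 → 0 < W.Δ → padicValNat 2 W.tamagawaProduct = 0 → MeetsEgg W → BSDp W 2 := by
  intro W _ _ hcm hr hSel _hΔ hC0 hegg
  haveI : NeZero (W.conductorNorm ℤ) := ⟨(W.conductorNorm_pos_holds).ne'⟩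
  have hT : Odd W.tamagawaProduct := by
    rcases Nat.even_or_odd W.tamagawaProduct with h | h
    · exfalso
      have h2 : 2 ∣ W.tamagawaProduct := even_iff_two_dvd.mp h
      have h1 : 1 ≤ padicValNat 2 W.tamagawaProduct :=
        one_le_padicValNat_of_dvd W.tamagawaProduct_pos_holds.ne' h2
      omega
    · exact h
  obtain ⟨K, iF, iN, hK, hodd, h3, hH, Dt, β, ι, d₁, hc0, hy, ⟨M₀, hcM, hdiv, hndiv⟩, Wd, iE, iM, hWd, hSel1, hbudget⟩ :=
    hS2egg W hcm hr hSel hT (Or.inr hegg)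
  haveI hEK : (W.baseChange K).IsElliptic := isElliptic_baseChange' W K
  have hD0 : (NumberField.discr K : ℚ) ≠ 0 := by exact_mod_cast NumberField.discr_ne_zero K
  haveI hEt : (W.quadraticTwist (NumberField.discr K : ℚ)).IsElliptic := W.isElliptic_quadraticTwist hD0
  obtain ⟨Cd, hCd⟩ := hWd
  -- the twin is non-CM (same `j`) of analytic rank `0`: `BSD₂(Wd)` from S1
  have hcmd : ¬ Wd.HasCM := by
    rw [← hCd, hasCM_iff_of_j_eq (((W.quadraticTwist (NumberField.discr K : ℚ)).variableChange_j Cd).trans (W.j_quadraticTwist hD0))]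
    exact hcm
  obtain ⟨P₀, Hd, hP₀, hP₀K⟩ := exists_heegnerPoint_map_eq_derivedPoint_one hK hH d₁
  have hPinf : ¬ IsOfFinAddOrder P₀ := by
    intro hfin
    apply hy
    rw [← hP₀K]
    exact (WeierstrassCurve.Affine.Point.map (W' := W)
      (algebraMap K (ringClassField K ι 1)).toRatAlgHom).isOfFinAddOrder hfin
  have hrt : (W.quadraticTwist (NumberField.discr K : ℚ)).analyticRank = 0 :=
    analyticRank_twist_eq_zero_of_rankOne W K (hGZ _ W K) hmod hK hH hr ⟨Dt, Hd, ι, hP₀⟩ hPinf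
  have hrd : Wd.analyticRank = 0 := by rw [← hCd, analyticRank_smul, hrt]
  have hΔd : 0 < Wd.Δ := (Δ_twin_pos_iff W hD0 Cd hCd).mpr _hΔ
  have hC0d : padicValNat 2 Wd.tamagawaProduct = 0 := by
    rcases hbudget with ⟨hneg, -⟩ | h0
    · exact absurd _hΔ (not_lt.mpr hneg.le)
    · exact h0
  have hBd : BSDp Wd 2 := hS1pos Wd hcmd hrd hSel1 hΔd hC0d
  exact swappedPairDescentAtTwo_maninExponent_of_facts hGZ hGZK hmod hMilneC W hr hSel hT K hK hodd h3 hH Dt hc0 β ι d₁ hy M₀ hcM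
    hdiv hndiv Wd ⟨Cd, hCd⟩ hSel1 hbudget hBd

/-! ## §2 `closes` (rev 57) with U₂ replaced by the sliced wall, S2″⁺, S2⁻′ and the residual `hTw0^{id}` -/

/-- **THE EGG-SPLIT LEDGER ON REV 57: U₂ ↦ «S1⁺ + S1⁻ + S2″⁺ + S2⁻′ + hTw0^{id,S₃}».**  `Line25.nonCMAtTwo_of_items_of_tamagawaSlicedSurjTwin_line25`
(`closes` with `hTw` sliced to the S₃-cells) with `hTw0ˢ` split on `MeetsEgg`: the egg half by §1 (S1⁺ + S2″⁺ + PRINT), the identity half by the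
DISPLAYED RESIDUAL `hTw0id` (non-CM, `r_an = 1`, `#Sel₂ = 2`, `ρ̄_{W,2}` onto, `0 < Δ`, `ord₂ C = 0`, `¬ MeetsEgg` ⟹ `BSD₂`); `hTw1ˢ` by p768862's
`hTw1_of_slicedWall_of_reversedSupplyDepthOnePrime_of_facts` (S1⁻ + S2⁻′ + PRINT).  All other binders = the route's items as in `closes` (rev 57).
CONDITIONAL on the displayed hypotheses; proves nothing about BSD by itself; closes no item.
[cite: Kramer1981, §2 Props. 3, 6] [cite: MazurRubin2010, Cor. 3.4 (i)] [cite: GrossZagier1986, V.§2 (2.2)] [cite: Miller2011LMS, Def. 1.1] -/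
theorem nonCMAtTwo_of_items_of_slicedWall_of_reversedSuppliesEgg_line25
    (hP : GenusPrimitiveSupplyAtTwoPosDiscShallow) (hPG : GenusDeepSupplyAtTwoNegDiscNarrow) (hQ1 : CyclicTorsionOfNegDisc)
    (hQ2 : KolyvaginRelationAtTwo)
    (hQ5R : EquivariantChebotarevAtTwoR) (hQ3RT : EquivariantKolyvaginExactAtTwoRT)
    (hQ4T : KolyvaginExactAtTwoPosDiscT) (hGf : ExactDescentAtTwoOfFourFacts)
    (hR : OffHabitatResidualAtTwo) (hOff : OffCutResidualAtTwoR)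
    (hK1P : K1Pos) (hK1N : K1Neg) (hSha1 : ShaVanishingAtDepthZeroAtTwo)
    (hS1pos : ∀ (W : WeierstrassCurve ℚ) [W.IsElliptic] [W.IsGloballyMinimal],
      ¬ W.HasCM → W.analyticRank = 0 → Nat.card (W.selmerGroup 2) = 1 → 0 < W.Δ → padicValNat 2 W.tamagawaProduct = 0 → BSDp W 2)
    (hS1neg : ∀ (W : WeierstrassCurve ℚ) [W.IsElliptic] [W.IsGloballyMinimal],
      ¬ W.HasCM → W.analyticRank = 0 → Nat.card (W.selmerGroup 2) = 1 → W.Δ < 0 → padicValNat 2 W.tamagawaProduct = 2 → BSDp W 2)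
    (hS2egg : ∀ (W : WeierstrassCurve ℚ) [W.IsElliptic] [W.IsGloballyMinimal] [NeZero (W.conductorNorm ℤ)],
      ¬ W.HasCM → W.analyticRank = 1 → Nat.card (W.selmerGroup 2) = 2 → Odd W.tamagawaProduct → (W.Δ < 0 ∨ MeetsEgg W) →
      ∃ (K : Type) (_ : Field K) (_ : NumberField K),
        IsImaginaryQuadratic K ∧ Odd (NumberField.discr K) ∧ NumberField.discr K ≠ -3 ∧ SatisfiesHeegnerHypothesis (W.conductorNorm ℤ) K ∧
        ∃ (Dt : ModularParametrizationData W (W.conductorNorm ℤ)) (β : ℤ) (ι : K →+* ℂ) (d₁ : KolyvaginHeegnerData Dt β ι 1),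
          Dt.c ≠ 0 ∧ ¬ IsOfFinAddOrder d₁.derivedPoint ∧
          (∃ M₀ : ℕ, padicValInt 2 Dt.c = M₀ ∧
            (∃ Q : (W.baseChange (ringClassField K ι 1)).toAffine.Point, ((2 ^ M₀ : ℕ) : ℤ) • Q = d₁.derivedPoint) ∧
            (¬ ∃ Q : (W.baseChange (ringClassField K ι 1)).toAffine.Point, ((2 ^ (M₀ + 1) : ℕ) : ℤ) • Q = d₁.derivedPoint)) ∧
          ∃ (Wd : WeierstrassCurve ℚ) (_ : Wd.IsElliptic) (_ : Wd.IsGloballyMinimal),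
            (∃ C : VariableChange ℚ, C • W.quadraticTwist (NumberField.discr K : ℚ) = Wd) ∧ Nat.card (Wd.selmerGroup 2) = 1 ∧
            ((W.Δ < 0 ∧ padicValNat 2 Wd.tamagawaProduct ≤ 1) ∨ padicValNat 2 Wd.tamagawaProduct = 0))
    (hS2p : ∀ (W : WeierstrassCurve ℚ) [W.IsElliptic] [W.IsGloballyMinimal] [NeZero (W.conductorNorm ℤ)],
      ¬ W.HasCM → W.analyticRank = 1 → Nat.card (W.selmerGroup 2) = 2 → W.Δ < 0 → padicValNat 2 W.tamagawaProduct = 1 →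
      ∃ (K : Type) (_ : Field K) (_ : NumberField K),
        IsImaginaryQuadratic K ∧ (∃ ℓ : ℕ, ℓ.Prime ∧ NumberField.discr K = -(ℓ : ℤ)) ∧ Odd (NumberField.discr K) ∧
        NumberField.discr K ≠ -3 ∧ SatisfiesHeegnerHypothesis (W.conductorNorm ℤ) K ∧
        ∃ (Dt : ModularParametrizationData W (W.conductorNorm ℤ)) (β : ℤ) (ι : K →+* ℂ) (d₁ : KolyvaginHeegnerData Dt β ι 1),
          Dt.c ≠ 0 ∧ ¬ IsOfFinAddOrder d₁.derivedPoint ∧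
          (∃ Q : (W.baseChange (ringClassField K ι 1)).toAffine.Point,
            ((2 ^ (padicValInt 2 Dt.c + 1) : ℕ) : ℤ) • Q = d₁.derivedPoint) ∧
          (¬ ∃ Q : (W.baseChange (ringClassField K ι 1)).toAffine.Point,
            ((2 ^ (padicValInt 2 Dt.c + 1 + 1) : ℕ) : ℤ) • Q = d₁.derivedPoint) ∧
          ∃ (Wd : WeierstrassCurve ℚ) (_ : Wd.IsElliptic) (_ : Wd.IsGloballyMinimal),
            (∃ C : WeierstrassCurve.VariableChange ℚ, C • W.quadraticTwist (NumberField.discr K : ℚ) = Wd) ∧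
            Nat.card (Wd.selmerGroup 2) = 1)
    (hTw0id : ∀ (W : WeierstrassCurve ℚ) [W.IsElliptic] [W.IsGloballyMinimal], ¬ W.HasCM → W.analyticRank = 1 →
      Nat.card (W.selmerGroup 2) = 2 → W.HasSurjectiveModNGaloisRep 2 → 0 < W.Δ → padicValNat 2 W.tamagawaProduct = 0 →
      ¬ MeetsEgg W → BSDp W 2)
    (hL : EntireLFunctionRat)
    (hGZ : GrossZagierAllLevels) (hGZK : MultPublishedInputsAtTwo) (hMi : MilneAnyModel) :
    NonCMAtTwo :=
  nonCMAtTwo_of_items_of_tamagawaSlicedSurjTwin_line25 hP hPG hQ1 hQ2 hQ5R hQ3RT hQ4T hGf hR hOff hK1P hK1N hSha1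
    (fun W _ _ hcm hr hSel hsurj hΔ hC0 ↦ by
      by_cases hegg : MeetsEgg W
      · exact hTw0egg_of_slicedWall_of_reversedSupplyExponentEgg_of_facts hGZ hGZK hL hMi hS1pos hS2egg W hcm hr hSel hΔ hC0 hegg
      · exact hTw0id W hcm hr hSel hsurj hΔ hC0 hegg)
    (fun W _ _ hcm hr hSel _ hΔ hC1 ↦
      hTw1_of_slicedWall_of_reversedSupplyDepthOnePrime_of_facts hGZ hGZK hL hMi hS1neg hS2p W hcm hr hSel hΔ hC1)
    hL hGZ hGZK hMi

end Summit.BirchSwinnertonDyer.BirchSwinnertonDyer.Theorems.GenusExact.TwinSwap.Ledger.Line25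

end
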